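import Mathlib.Algebra.MvPolynomial.Degrees
import Mathlib.Algebra.MvPolynomial.Funext
import Mathlib.LinearAlgebra.Matrix.NonsingularInverse
import Literature.Algebra.EuclideanLattices.Problems
import Literature.Computability.MetaComplexity.TaylorCosineMinorants
import HarnessLib

/-!
# Dual-phase branching refutations of lattice closeness (a semi-algebraic proof system for `GapCVP`)

Topic `Computability/MetaComplexity`; definition item `defn-DualPhaseBranchingRefutation` of route
`PneNP/LatticeMagic` (the rung above the Taylor-minorant certificates of `TaylorMinorantsBuySqrtK`).

## The object

Fix an instance `((B, t), r)` of `GapCVP` (`B ∈ ℤⁿˣⁿ`, rows generate `L = L(B)`; `t ∈ ℤⁿ`;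
`r ∈ ℚ`; tree type `GapCVPInstance`). A REFUTATION of the closeness claim
"some `z ∈ ℤⁿ` has `‖z B - t‖ ≤ r`" is a finite rooted binary tree
(`DualPhaseBranchingRefutation n`):

* an internal node `branch a b T₁ T₂` carries `a ∈ ℤⁿ`, `b ∈ ℤ` and splits its cell (a polyhedron
  in `z`-space; root cell `ℝⁿ`) by the integer disjunction `⟨a, z⟩ ≤ b` (child `T₁`) or
  `⟨a, z⟩ ≥ b + 1` (child `T₂`) — the branching rule of general BRANCHING PROOFS
  (Dadush–Tiwari 2020, §1.1) alias STABBING PLANES (Beame et al. 2018); a cell is recorded as a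
  list of pairs `(a', b')` meaning `⟨a', z⟩ ≥ b'` (`⟨a, z⟩ ≤ b` is stored as `(-a, -b)`);
* a leaf `leaf Λ` with cell `P` carries an order-`K` TAYLOR-MINORANT CERTIFICATE valid on `P`
  (`TaylorLeaf n`): atoms `(c_j ∈ ℚ, a_j ∈ ℤⁿ, m_j ∈ ℤ, M_j ∈ ℕ)`, `j < N`, obeying the PARITY RULE
  `c_j ≥ 0 ⇒ M_j` odd, `c_j < 0 ⇒ M_j` even; a threshold `θ ∈ ℚ` with
  `∑_j c_j cos(2π φ_j) < θ`, where `φ_j = ⟨B⁻¹ a_j, t⟩ = ⟨w_j, t⟩` is the DUAL PHASE of the dual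
  vector `w_j = B⁻¹ a_j ∈ L*` (`⟨w_j, z B - t⟩ = ⟨a_j, z⟩ - φ_j`); and a Putinar-type
  Positivstellensatz identity in `ℝ[z₁, …, zₙ]` (`MvPolynomial (Fin n) ℝ`)
  `∑_j c_j T_{M_j}(2π(⟨a_j, z⟩ - φ_j - m_j)) - θ = σ₀ + σ₁ · (r² - ‖z B - t‖²) + ∑_ℓ τ_ℓ · g_ℓ`,
  `T_M(y) = ∑_{i ≤ M} (-1)^i y^{2i}/(2i)!`, with `σ₀, σ₁, τ_ℓ` explicit sums of squares of real
  polynomials and each `g_ℓ = ⟨a', z⟩ - b'` a constraint of the cell `P`.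

SOUNDNESS (proved, `IsDualPhaseBranchingRefutation.lt_dist` / `.not_mem_yes`): the leaf cells
cover `ℤⁿ` (an integer point satisfies exactly one side of each disjunction); at an integer `z` of
a leaf cell with `‖z B - t‖ ≤ r` the identity evaluates to `∑_j c_j T_{M_j}(…) - θ ≥ 0`, the
parity rule and the global Taylor inequalities (`TaylorCosineMinorants.lean`) give
`c_j T_{M_j}(y) ≤ c_j cos y`, and integrality of `⟨a_j, z⟩ - m_j` gives
`cos(2π(⟨a_j, z⟩ - φ_j - m_j)) = cos(2π φ_j)`, so `θ ≤ ∑_j c_j cos(2π φ_j) < θ`. Hence a refuted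
instance has NO lattice vector within `r` of `t`, in particular it is not a YES instance of
`GapCVP_γ` (any `γ`).

MEASURES: `length` = number of nodes (Dadush–Tiwari's `|T|`); `size` = nodes + atoms + total bit
size of all integers/rationals (`a, b` at branchings; `c_j, a_j, m_j, M_j, θ` at leaves; the
analogue of `⟨T⟩`); the Taylor `order` (`max M_j`) and the `sosDegree` (max total degree of the
squared polynomials) are separate parameters — the SOS multipliers have REAL coefficients and are
measured by degree only, as in SOS proof complexity (cf. `SumOfSquares.lean`).

SPECIAL CASES (format level): no atoms and degree-0 multipliers at every leaf = certified branching
proofs / Stabbing Planes with Farkas leaves for the ellipsoid `‖z B - t‖ ≤ r` (Dadush–Tiwari 2020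
§1.1 allow any compact convex `K`); a single leaf, all `M_j = 1`, `c_j = 1/N`, `σ₁` a constant and
`σ₀` the squares of linear forms of a PSD certificate `κ I - W Wᵀ ≽ 0` = the Aharonov–Regev verifier
(AharonovRegev2005 §6.1; tree: `FarCert.Accepts`, `GapCVPCoNPWitness.lean`); a single leaf of
order `k` = the certificate shape of Aggarwal et al. (arXiv:2211.11693, Thm. 1.2, pp. 9–10).

## Design notes

* `φ_j` is COMPUTED from `(B, t, a_j)` over `ℝ` as `t ⬝ᵥ (B⁻¹ *ᵥ a_j)` (`Matrix` inverse of the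
  cast basis; for singular `B` Mathlib's inverse is `0` — soundness holds for any value of the
  phases, nonsingularity is part of the `GapCVP` promise, not of the format). Dual vectors enter by
  their integer coordinates `a_j = (⟨w_j, bᵢ⟩)ᵢ` exactly as in `FarCert` (`GapCVPCoNPWitness.lean`,
  `FarCert.phase = det B · φ_j`) and `LatticeInstance.dualSampleMatrix` (`GapCVPCoNPSample.lean`).
* Rational data (`c_j, θ`) and integer data (`a_j, m_j, M_j`, branchings) are counted in `size`;
  the SOS polynomials are `MvPolynomial (Fin n) ℝ` and enter only through `sosDegree`.
* Multipliers `τ` are attached to constraints BY VALUE: `τ` is a list of pairs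
  (constraint `(a', b')`, list of polynomials), valid only if the constraint occurs in the cell.
* The check `∑ c_j cos(2πφ_j) < θ` is a `Prop` (transcendental); the format is a semi-algebraic
  proof system, not a Cook–Reckhow verifier (the requester's choice: "a noncomputable checker is
  fine").

## References

* D. Dadush, S. Tiwari, *On the complexity of branching proofs*, CCC 2020, §1.1 (pp. 3–4 of
  arXiv:2006.04124: general and certified branching proofs, `|T|`, `⟨T⟩`).
* P. Beame, N. Fleming, R. Impagliazzo, A. Kolokolova, D. Pankratov, T. Pitassi, R. Robere,
  *Stabbing Planes*, ITCS 2018.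
* D. Aharonov, O. Regev, *Lattice problems in NP ∩ coNP*, J. ACM 52 (2005), §6, §6.1.
* D. Aggarwal et al., *Lattice problems beyond polynomial time*, arXiv:2211.11693, Thm. 1.2,
  pp. 9–10.
-/

noncomputable section

open MvPolynomial Matrix Finset Literature.Algebra.EuclideanLattices

namespace Literature.Computability.MetaComplexity

variable {n : ℕ}

/-! ### Polynomial building blocks -/

/-- The Taylor polynomial of `cos` of degree `2M`, `T_M(y) = ∑_{i ≤ M} (-1)^i y^{2i}/(2i)!`, as a
real function (same expression as in `TaylorCosineMinorants.lean` and `TaylorMinorantsBuySqrtK`).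
[folklore] -/
def taylorCos (M : ℕ) (y : ℝ) : ℝ :=
  ∑ i ∈ range (M + 1), (-1 : ℝ) ^ i * y ^ (2 * i) / ((2 * i).factorial : ℝ)

/-- `T_M(q)` for a polynomial `q`: `∑_{i ≤ M} ((-1)^i/(2i)!) · q^{2i}`. [folklore] -/
def taylorCosPoly {σ : Type*} (M : ℕ) (q : MvPolynomial σ ℝ) : MvPolynomial σ ℝ :=
  ∑ i ∈ range (M + 1), C ((-1 : ℝ) ^ i / ((2 * i).factorial : ℝ)) * q ^ (2 * i)

/-- The affine form `⟨a, z⟩ - b` as a polynomial in `z₁, …, zₙ`. [folklore] -/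
def linPoly (a : Fin n → ℤ) (b : ℝ) : MvPolynomial (Fin n) ℝ :=
  (∑ i, C (a i : ℝ) * X i) - C b

/-- `‖z B - t‖² = ∑_k (∑_i z_i B_{ik} - t_k)²` as a polynomial in `z`. [folklore] -/
def distSqPoly (B : Matrix (Fin n) (Fin n) ℤ) (t : Fin n → ℤ) : MvPolynomial (Fin n) ℝ :=
  ∑ k, linPoly (fun i => B i k) (t k : ℝ) ^ 2

/-- An explicit sum of squares `∑_{q ∈ l} q²`. [folklore] -/
def sumSq (l : List (MvPolynomial (Fin n) ℝ)) : MvPolynomial (Fin n) ℝ :=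
  (l.map fun q => q ^ 2).sum

/-- The DUAL PHASE `φ = ⟨B⁻¹ a, t⟩ = ⟨w, t⟩` of the dual vector `w = B⁻¹ a` (`a ∈ ℤⁿ` its integer
coordinates: `⟨w, bᵢ⟩ = aᵢ`), so that `⟨w, z B - t⟩ = ⟨a, z⟩ - φ`; computed over `ℝ`.
[cite: AharonovRegev2005, §6 test (a) (the phases ⟨wⱼ, v⟩ of f_W)] -/
def dualPhase (B : Matrix (Fin n) (Fin n) ℤ) (t : Fin n → ℤ) (a : Fin n → ℤ) : ℝ :=
  (fun k => (t k : ℝ)) ⬝ᵥ ((B.map (Int.cast : ℤ → ℝ))⁻¹ *ᵥ fun i => (a i : ℝ))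

/-! ### Leaves, trees, validity -/

/-- An order-`K` Taylor-minorant leaf certificate in dimension `n`: `N` atoms
`(c_j, a_j, m_j, M_j)`, a threshold `θ`, and the SOS data `σ₀`, `σ₁`, `τ` of a Putinar-type
identity (see the module docstring). [cite: arXiv221111693, Thm. 1.2 and pp. 9–10 (order-k Taylor certificates); AharonovRegev2005 §6.1 for order 1] -/
structure TaylorLeaf (n : ℕ) where
  /-- number of Taylor atoms -/
  N : ℕ
  /-- rational weights `c_j` -/
  c : Fin N → ℚ
  /-- integer coordinates `a_j = B w_j` of the dual vectors -/
  a : Fin N → Fin n → ℤ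
  /-- integer shifts `m_j` (which period of `cos` the Taylor polynomial is centred on) -/
  m : Fin N → ℤ
  /-- Taylor orders `M_j` (`T_{M_j}` has degree `2 M_j`) -/
  M : Fin N → ℕ
  /-- the threshold `θ` -/
  θ : ℚ
  /-- `σ₀`: polynomials whose squares sum to the free SOS term -/
  σ₀ : List (MvPolynomial (Fin n) ℝ)
  /-- `σ₁`: polynomials whose squares sum to the multiplier of `r² - ‖z B - t‖²` -/
  σ₁ : List (MvPolynomial (Fin n) ℝ)
  /-- `τ`: for cell constraints `(a', b')` (`⟨a', z⟩ ≥ b'`), polynomials whose squares sum to the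
  multiplier of `⟨a', z⟩ - b'` -/
  τ : List (((Fin n → ℤ) × ℤ) × List (MvPolynomial (Fin n) ℝ))

/-- A dual-phase branching refutation tree in dimension `n`: leaves carry Taylor-minorant
certificates, internal nodes branch on an integer disjunction `⟨a, z⟩ ≤ b ∨ ⟨a, z⟩ ≥ b + 1`.
[cite: DadushTiwari2020, §1.1 (general branching proofs; certified leaves)] -/
inductive DualPhaseBranchingRefutation (n : ℕ) : Type
  /-- a leaf with its Taylor-minorant certificate -/
  | leaf (Λ : TaylorLeaf n) : DualPhaseBranchingRefutation n
  /-- branch on `⟨a, z⟩ ≤ b` (first child) or `⟨a, z⟩ ≥ b + 1` (second child) -/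
  | branch (a : Fin n → ℤ) (b : ℤ) (T₁ T₂ : DualPhaseBranchingRefutation n) :
      DualPhaseBranchingRefutation n

namespace TaylorLeaf

/-- The minorant side `∑_j c_j T_{M_j}(2π(⟨a_j, z⟩ - φ_j - m_j)) - θ` of a leaf, as a polynomial in
`z`. [cite: arXiv221111693, pp. 9–10 (f_W^{(k)})] -/
def minorantPoly (Λ : TaylorLeaf n) (B : Matrix (Fin n) (Fin n) ℤ) (t : Fin n → ℤ) :
    MvPolynomial (Fin n) ℝ :=
  (∑ j, C (Λ.c j : ℝ) * taylorCosPoly (Λ.M j)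
      (C (2 * Real.pi) * linPoly (Λ.a j) (dualPhase B t (Λ.a j) + Λ.m j))) - C (Λ.θ : ℝ)

/-- The certificate side `σ₀ + σ₁ · (r² - ‖z B - t‖²) + ∑_ℓ τ_ℓ · (⟨a'_ℓ, z⟩ - b'_ℓ)`.
[folklore] -/
def certPoly (Λ : TaylorLeaf n) (B : Matrix (Fin n) (Fin n) ℤ) (t : Fin n → ℤ) (r : ℚ) :
    MvPolynomial (Fin n) ℝ :=
  sumSq Λ.σ₀ + sumSq Λ.σ₁ * (C ((r : ℝ) ^ 2) - distSqPoly B t) +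
    (Λ.τ.map fun e => sumSq e.2 * linPoly e.1.1 (e.1.2 : ℝ)).sum

/-- **Validity of a leaf certificate on a cell `P`** for the instance data `(B, t, r)`: the parity
rule, the threshold inequality `∑_j c_j cos(2π φ_j) < θ`, every multiplier constraint belongs to
`P`, and the Positivstellensatz identity `minorantPoly = certPoly` holds in `ℝ[z]`.
[cite: arXiv221111693, Thm. 1.2 and pp. 9–10; AharonovRegev2005 §6 tests (a), (c)] -/
def ValidOn (Λ : TaylorLeaf n) (B : Matrix (Fin n) (Fin n) ℤ) (t : Fin n → ℤ) (r : ℚ)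
    (P : List ((Fin n → ℤ) × ℤ)) : Prop :=
  (∀ j, (0 ≤ Λ.c j → Odd (Λ.M j)) ∧ (Λ.c j < 0 → Even (Λ.M j))) ∧
    (∑ j, (Λ.c j : ℝ) * Real.cos (2 * Real.pi * dualPhase B t (Λ.a j)) < Λ.θ) ∧
    (∀ e ∈ Λ.τ, e.1 ∈ P) ∧
    Λ.minorantPoly B t = Λ.certPoly B t r

/-- Bit sizes: an integer costs its binary length plus a sign bit, a rational the lengths of
numerator and denominator plus a sign bit. [folklore] -/
def intBits (z : ℤ) : ℕ := z.natAbs.size + 1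

/-- See `intBits`. [folklore] -/
def ratBits (q : ℚ) : ℕ := q.num.natAbs.size + q.den.size + 1

/-- The bit size of a leaf: number of atoms plus the bits of all `c_j, a_j, m_j, M_j` and `θ`
(SOS data excluded — measured by `sosDegree`). [cite: DadushTiwari2020, §1.1 (⟨T⟩ includes the leaf certificates)] -/
def bitSize (Λ : TaylorLeaf n) : ℕ :=
  Λ.N + ratBits Λ.θ +
    ∑ j, (ratBits (Λ.c j) + (∑ i, intBits (Λ.a j i)) + intBits (Λ.m j) + (Λ.M j).size)

/-- The Taylor order `K = max_j M_j` of a leaf. [cite: arXiv221111693, Thm. 1.2 (the order k)] -/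
def order (Λ : TaylorLeaf n) : ℕ := univ.sup Λ.M

/-- The SOS degree of a leaf: the maximal total degree of a polynomial squared in `σ₀, σ₁, τ`.
[folklore] -/
def sosDegree (Λ : TaylorLeaf n) : ℕ :=
  ((Λ.σ₀ ++ Λ.σ₁ ++ (Λ.τ.map Prod.snd).flatten).map MvPolynomial.totalDegree).foldr max 0

end TaylorLeaf

namespace DualPhaseBranchingRefutation

/-- **Validity of a tree on a cell** for the instance data `(B, t, r)`: leaves are valid on their
cell; a branching `(a, b)` passes `⟨a, z⟩ ≤ b` (stored as `(-a, -b)`) to its first child and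
`⟨a, z⟩ ≥ b + 1` (stored as `(a, b + 1)`) to its second. [cite: DadushTiwari2020, §1.1] -/
def ValidOn (B : Matrix (Fin n) (Fin n) ℤ) (t : Fin n → ℤ) (r : ℚ) :
    DualPhaseBranchingRefutation n → List ((Fin n → ℤ) × ℤ) → Prop
  | leaf Λ, P => Λ.ValidOn B t r P
  | branch a b T₁ T₂, P => ValidOn B t r T₁ ((-a, -b) :: P) ∧ ValidOn B t r T₂ ((a, b + 1) :: P)

/-- The LENGTH `|T|`: number of nodes. [cite: DadushTiwari2020, §1.1] -/
def length : DualPhaseBranchingRefutation n → ℕ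
  | leaf _ => 1
  | branch _ _ T₁ T₂ => T₁.length + T₂.length + 1

/-- The SIZE: number of nodes + number of atoms + total bit size of all integers and rationals
(branching data `a, b`; leaf data `c_j, a_j, m_j, M_j, θ`). [cite: DadushTiwari2020, §1.1 (⟨T⟩)] -/
def size : DualPhaseBranchingRefutation n → ℕ
  | leaf Λ => 1 + Λ.bitSize
  | branch a b T₁ T₂ => 1 + (∑ i, TaylorLeaf.intBits (a i)) + TaylorLeaf.intBits b + T₁.size + T₂.size

/-- The Taylor ORDER `K` of a refutation: the maximum of `M_j` over all atoms of all leaves.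
[cite: arXiv221111693, Thm. 1.2] -/
def order : DualPhaseBranchingRefutation n → ℕ
  | leaf Λ => Λ.order
  | branch _ _ T₁ T₂ => max T₁.order T₂.order

/-- The SOS DEGREE of a refutation: the maximum over leaves of `TaylorLeaf.sosDegree`. [folklore] -/
def sosDegree : DualPhaseBranchingRefutation n → ℕ
  | leaf Λ => Λ.sosDegree
  | branch _ _ T₁ T₂ => max T₁.sosDegree T₂.sosDegree

end DualPhaseBranchingRefutation

/-- **`T` is a dual-phase branching refutation of the `GapCVP` instance `p = ((B, t), r)`**: the
tree is valid on the root cell `ℝⁿ` (no constraints), i.e. it refutes "some `z ∈ ℤⁿ` has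
`‖z B - t‖ ≤ r`" (see `IsDualPhaseBranchingRefutation.lt_dist`).
[cite: DadushTiwari2020, §1.1 (branching proofs); arXiv221111693 Thm. 1.2 / AharonovRegev2005 §6 (the leaves)] -/
def IsDualPhaseBranchingRefutation (p : GapCVPInstance)
    (T : DualPhaseBranchingRefutation p.1.I.n) : Prop :=
  T.ValidOn p.1.I.basis p.1.target p.2 []

/-! ### API: unfolding -/

/-- Unfolding at a leaf. [folklore] -/
theorem isDualPhaseBranchingRefutation_leaf_iff (p : GapCVPInstance) (Λ : TaylorLeaf p.1.I.n) :
    IsDualPhaseBranchingRefutation p (.leaf Λ) ↔ Λ.ValidOn p.1.I.basis p.1.target p.2 [] :=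
  Iff.rfl

/-- Unfolding at a branching. [folklore] -/
theorem DualPhaseBranchingRefutation.validOn_branch_iff (B : Matrix (Fin n) (Fin n) ℤ)
    (t : Fin n → ℤ) (r : ℚ) (a : Fin n → ℤ) (b : ℤ) (T₁ T₂ : DualPhaseBranchingRefutation n)
    (P : List ((Fin n → ℤ) × ℤ)) :
    (DualPhaseBranchingRefutation.branch a b T₁ T₂).ValidOn B t r P ↔
      T₁.ValidOn B t r ((-a, -b) :: P) ∧ T₂.ValidOn B t r ((a, b + 1) :: P) :=
  Iff.rfl

/-- `|T| ≤ size T`. [folklore] -/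
theorem DualPhaseBranchingRefutation.length_le_size (T : DualPhaseBranchingRefutation n) :
    T.length ≤ T.size := by
  induction T with
  | leaf Λ => simp [DualPhaseBranchingRefutation.length, DualPhaseBranchingRefutation.size]
  | branch a b T₁ T₂ ih₁ ih₂ =>
    simp only [DualPhaseBranchingRefutation.length, DualPhaseBranchingRefutation.size]
    omega

/-! ### Evaluation lemmas -/

/-- `T_M(q)(x) = T_M(q(x))`. [folklore] -/
theorem eval_taylorCosPoly {σ : Type*} (M : ℕ) (q : MvPolynomial σ ℝ) (x : σ → ℝ) :
    eval x (taylorCosPoly M q) = taylorCos M (eval x q) := by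
  simp only [taylorCosPoly, taylorCos, map_sum, map_mul, eval_C, map_pow]
  exact Finset.sum_congr rfl fun i _ => by ring

/-- `(⟨a, z⟩ - b)(x) = ∑ aᵢ xᵢ - b`. [folklore] -/
theorem eval_linPoly (a : Fin n → ℤ) (b : ℝ) (x : Fin n → ℝ) :
    eval x (linPoly a b) = (∑ i, (a i : ℝ) * x i) - b := by
  simp [linPoly, map_sum]

/-- `‖z B - t‖²(x) = ∑_k (∑_i B_{ik} x_i - t_k)²`. [folklore] -/
theorem eval_distSqPoly (B : Matrix (Fin n) (Fin n) ℤ) (t : Fin n → ℤ) (x : Fin n → ℝ) :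
    eval x (distSqPoly B t) = ∑ k, ((∑ i, (B i k : ℝ) * x i) - t k) ^ 2 := by
  simp [distSqPoly, map_sum, eval_linPoly]

/-- A sum of squares evaluates to a nonnegative real. [folklore] -/
theorem eval_sumSq_nonneg (x : Fin n → ℝ) (l : List (MvPolynomial (Fin n) ℝ)) :
    0 ≤ eval x (sumSq l) := by
  unfold sumSq
  rw [map_list_sum, List.map_map]
  refine List.sum_nonneg fun v hv => ?_
  obtain ⟨q, -, rfl⟩ := List.mem_map.1 hv
  simp only [Function.comp_apply, map_pow]
  positivity

/-! ### Soundness -/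

/-- **Leaf soundness**: a leaf certificate valid on `P` excludes every integer point of `P` from
the ball: `r² < ‖z B - t‖²`. Mechanism: evaluate the identity at `z`; the certificate side is
`≥ 0`; the parity rule with the global Taylor bounds and the integrality of `⟨a_j, z⟩ - m_j` bound
the minorant side by `∑_j c_j cos(2π φ_j) - θ < 0`. [cite: AharonovRegev2005, §6.1 (soundness, order 1); arXiv221111693 pp. 9–10] -/
theorem TaylorLeaf.ValidOn.sound {Λ : TaylorLeaf n} {B : Matrix (Fin n) (Fin n) ℤ} {t : Fin n → ℤ}
    {r : ℚ} {P : List ((Fin n → ℤ) × ℤ)} (h : Λ.ValidOn B t r P) (z : Fin n → ℤ)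
    (hz : ∀ g ∈ P, g.2 ≤ g.1 ⬝ᵥ z) :
    (r : ℝ) ^ 2 < ∑ k, ((∑ i, (B i k : ℝ) * z i) - t k) ^ 2 := by
  obtain ⟨hpar, hθ, hτ, hid⟩ := h
  by_contra hle
  rw [not_lt] at hle
  set x : Fin n → ℝ := fun i => (z i : ℝ) with hx
  -- the certificate side is nonnegative at `z`
  have hR : 0 ≤ eval x (Λ.certPoly B t r) := by
    simp only [TaylorLeaf.certPoly, map_add, map_mul, map_sub, eval_C, eval_distSqPoly,
      map_list_sum, List.map_map]
    refine add_nonneg (add_nonneg (eval_sumSq_nonneg x _)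
      (mul_nonneg (eval_sumSq_nonneg x _) (by simp only [hx]; linarith))) (List.sum_nonneg ?_)
    intro v hv
    obtain ⟨e, he, rfl⟩ := List.mem_map.1 hv
    simp only [Function.comp_apply, map_mul, eval_linPoly]
    refine mul_nonneg (eval_sumSq_nonneg x _) ?_
    have h1 : ((e.1.2 : ℤ) : ℝ) ≤ ((e.1.1 ⬝ᵥ z : ℤ) : ℝ) := by exact_mod_cast hz e.1 (hτ e he)
    have h2 : ((e.1.1 ⬝ᵥ z : ℤ) : ℝ) = ∑ i, (e.1.1 i : ℝ) * x i := by
      simp [dotProduct, hx]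
    linarith
  -- the minorant side is negative at `z`
  have hL : eval x (Λ.minorantPoly B t) < 0 := by
    simp only [TaylorLeaf.minorantPoly, map_sub, map_sum, map_mul, eval_C, eval_taylorCosPoly,
      eval_linPoly, sub_neg]
    refine lt_of_le_of_lt (Finset.sum_le_sum fun j _ => ?_) hθ
    have hk : (∑ i, (Λ.a j i : ℝ) * x i) - (dualPhase B t (Λ.a j) + Λ.m j) =
        ((Λ.a j ⬝ᵥ z - Λ.m j : ℤ) : ℝ) - dualPhase B t (Λ.a j) := by
      simp [dotProduct, hx]; ring
    rw [hk]
    calc (Λ.c j : ℝ) * taylorCos (Λ.M j)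
          (2 * Real.pi * (((Λ.a j ⬝ᵥ z - Λ.m j : ℤ) : ℝ) - dualPhase B t (Λ.a j)))
        ≤ (Λ.c j : ℝ) *
            Real.cos (2 * Real.pi * (((Λ.a j ⬝ᵥ z - Λ.m j : ℤ) : ℝ) - dualPhase B t (Λ.a j))) :=
          mul_cosTaylorSum_le_mul_cos (fun hc => (hpar j).1 (by exact_mod_cast hc))
            (fun hc => (hpar j).2 (by exact_mod_cast hc)) _
      _ = (Λ.c j : ℝ) * Real.cos (2 * Real.pi * dualPhase B t (Λ.a j)) := by
          rw [mul_sub, mul_comm (2 * Real.pi) ((Λ.a j ⬝ᵥ z - Λ.m j : ℤ) : ℝ),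
            Real.cos_int_mul_two_pi_sub]
  have hEq : eval x (Λ.minorantPoly B t) = eval x (Λ.certPoly B t r) := by rw [hid]
  linarith

/-- **Tree soundness on a cell**: a tree valid on `P` excludes every integer point of `P` from the
ball (induction: an integer point satisfies `⟨a, z⟩ ≤ b` or `⟨a, z⟩ ≥ b + 1`).
[cite: DadushTiwari2020, §1.1 ("any integer point must satisfy exactly one of these inequalities")] -/
theorem DualPhaseBranchingRefutation.ValidOn.sound {B : Matrix (Fin n) (Fin n) ℤ} {t : Fin n → ℤ}
    {r : ℚ} : ∀ {T : DualPhaseBranchingRefutation n} {P : List ((Fin n → ℤ) × ℤ)},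
    T.ValidOn B t r P → ∀ z : Fin n → ℤ, (∀ g ∈ P, g.2 ≤ g.1 ⬝ᵥ z) →
      (r : ℝ) ^ 2 < ∑ k, ((∑ i, (B i k : ℝ) * z i) - t k) ^ 2
  | .leaf _, _, h, z, hz => TaylorLeaf.ValidOn.sound h z hz
  | .branch a b T₁ T₂, P, h, z, hz => by
    rcases le_or_gt (a ⬝ᵥ z) b with hab | hab
    · refine DualPhaseBranchingRefutation.ValidOn.sound h.1 z fun g hg => ?_
      rcases List.mem_cons.1 hg with rfl | hg
      · simpa [neg_dotProduct] using hab
      · exact hz g hg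
    · refine DualPhaseBranchingRefutation.ValidOn.sound h.2 z fun g hg => ?_
      rcases List.mem_cons.1 hg with rfl | hg
      · exact hab
      · exact hz g hg

/-- **Soundness**: a refuted instance has no lattice vector within `r` of the target — for every
coefficient vector `z ∈ ℤⁿ`, `r < ‖z B - t‖`. [cite: DadushTiwari2020, §1.1; AharonovRegev2005 §6.1] -/
theorem IsDualPhaseBranchingRefutation.lt_dist {p : GapCVPInstance}
    {T : DualPhaseBranchingRefutation p.1.I.n} (h : IsDualPhaseBranchingRefutation p T)
    (z : Fin p.1.I.n → ℤ) : (p.2 : ℝ) < dist (p.1.I.ofCoeffs z) p.1.targetE := by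
  have h1 := DualPhaseBranchingRefutation.ValidOn.sound h z (by simp)
  rw [dist_eq_norm, LatticeInstance.ofCoeffs, CVPInstance.targetE, ← map_sub,
    norm_intVecToEuclidean]
  rcases lt_or_ge (p.2 : ℝ) 0 with hr | hr
  · exact hr.trans_le (Real.sqrt_nonneg _)
  · rw [Real.lt_sqrt hr]
    convert h1 using 2 with k
    simp [Matrix.vecMul, dotProduct, mul_comm]

/-- **Soundness against `GapCVP`**: an instance admitting a dual-phase branching refutation is not
a YES instance of `GapCVP_γ`, for any factor `γ` (a closest lattice vector exists since `L(B)` is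
closed). [cite: AharonovRegev2005, §6.1 (soundness); DadushTiwari2020 §1.1] -/
theorem IsDualPhaseBranchingRefutation.not_mem_yes {p : GapCVPInstance}
    {T : DualPhaseBranchingRefutation p.1.I.n} (h : IsDualPhaseBranchingRefutation p T)
    (γ : ℕ → ℝ) : p ∉ GapCVP.yes γ := by
  rintro ⟨-, -, hdist⟩
  have hclosed : IsClosed (X := EuclideanSpace ℝ (Fin p.1.I.n)) p.1.I.lattice :=
    @AddSubgroup.isClosed_of_discrete _ _ _ _ _ p.1.I.lattice.toAddSubgroup
      (inferInstanceAs (DiscreteTopology p.1.I.lattice))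
  obtain ⟨y, hyL, hy⟩ :=
    hclosed.exists_infDist_eq_dist ⟨0, p.1.I.lattice.zero_mem⟩ p.1.targetE
  obtain ⟨z, rfl⟩ := (p.1.I.mem_lattice_iff y).1 hyL
  have hlt := h.lt_dist z
  rw [dist_comm] at hlt
  rw [hy] at hdist
  linarith
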